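import Summits.CriticalPhenomena.CardyFormulaZ2.Theorems.CardyBoundaryCoulombGasBoundaryDefectGaussianRStubRealisabilityPart13
import Summits.CriticalPhenomena.CardyFormulaZ2.Theorems.CardyBoundaryCoulombGasBoundaryDefectGaussianRStubRealisabilityPart21

/-!
# Stub `stub_realisability` of line `rainbow-monomials-in-excursion-kernels` — Part 31 (open-edge
# levels, 1/4): footprints of an admissible leg insertion with FLAT insertion points
# (crux `BoundaryDefectGaussianR`, stmt-CriticalPhenomena-14132; insertion dictionary D2)

Notation as in Parts 7, 8, 13: `outDart V ι.sink = some d₀`, `ds = cycle V d₀`, `P = ds.length`,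
`st t` the walk state after `t` darts, `L = ι.sinkLegs`. A dart `t < P` is SILENT when
`st (t+1)` and `st t` have the same level and wiredness, ACTIVE otherwise (a junction or a jump).

* Cyclic indexing (`getElem_cycle_mod`, `getElem_succ_mod`, `getElem_pred_mod`,
  `st_mod_succ`): `ds[m % P] = dsucc^[m] d₀`, the dart after `t` is
  `ds[(t+1) % P] = dsucc ds[t]`, an exterior `dsucc`-predecessor of `ds[t]` is `ds[(t+P-1) % P]`,
  equal darts have equal indices (`se_cycle_index_inj`, Part 21), and across the seam the state `st ((t+1) % P)` has the level and
  wiredness of `st (t+1)` (the walk of an admissible datum closes up).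
* Footprints (`exists_start_of_pending`, `exists_start_of_active`, `startAt_eq_some`): legs are
  pending only within `L₀ - 1` darts after the start of an insertion of `L₀ ≤ L` legs, so an ACTIVE
  dart `s` is dart `j₀ ≤ L₀ - 1` of the footprint of an insertion point `x₀` (`outDart V x₀ = ds[s₀]`,
  `s = s₀ + j₀`).
* Flat insertion points (`flat_dir_eq`, `flat_frame`, `dsucc_straight`, `iterate_dsucc_straight`):
  if `V` is a half-plane in the lattice ball of radius `R` round `x₀` and `x₀ + dir k ∉ V`, then the
  half-plane is `{i ≤ 0}` in the frame `x₀ + j • dir (k+1) + i • dir k`, the darts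
  `(x₀ + j • dir (k+1), k)`, `|j| ≤ R - 2`, are exterior and `dsucc` moves them STRAIGHT
  (`j ↦ j + 1`).
* `straight_of_active`: consequently, with all insertion points flat at radius `L + 3`, the two
  darts before and the two darts after an ACTIVE dart `s = (y, k)` are its straight translates
  `(y ∓ dir (k+1), k)`, `(y ∓ 2 dir (k+1), k)` (cyclically, across the seam included).
Parts 32–34: local charts and the chain lemma; mentions along the walk; the levels of the
endpoints of open edges. Registered sub-goal carried here: `s13_flatStraight`.
-/

namespace Summit.CriticalPhenomena.CardyFormulaZ2.Cruxes.BoundaryDefectGaussianR.RainbowMonomialsInExcursionKernels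

open Literature.Probability.LatticeModels Literature.Probability.LatticeModels.CollarLegModel

/-! ### Flat insertion points: the frame of the exterior direction -/

/-- At a flat point `x` (half-plane chart of inward normal `dvec` on the ball of radius `R ≥ 1`)
with `x + dir k ∉ V`, the inward normal is `-dir k`. [folklore] -/
theorem flat_dir_eq {V : Finset (ℤ × ℤ)} {x dvec : ℤ × ℤ} {R : ℤ}
    (hd : dvec = (1, 0) ∨ dvec = (-1, 0) ∨ dvec = (0, 1) ∨ dvec = (0, -1))
    (hflat : ∀ v : ℤ × ℤ, (v.1 - x.1) ^ 2 + (v.2 - x.2) ^ 2 ≤ R ^ 2 →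
      (v ∈ V ↔ 0 ≤ (v.1 - x.1) * dvec.1 + (v.2 - x.2) * dvec.2))
    (hR : 1 ≤ R) {k : Fin 4} (hk : x + dir k ∉ V) : dvec = -dir k := by
  have hsq : (dir k).1 ^ 2 + (dir k).2 ^ 2 = 1 := by fin_cases k <;> simp [dir]
  have h1 := hflat (x + dir k) (by
    simp only [Prod.fst_add, Prod.snd_add, add_sub_cancel_left, hsq]; nlinarith)
  simp only [Prod.fst_add, Prod.snd_add, add_sub_cancel_left] at h1
  have hlt : (dir k).1 * dvec.1 + (dir k).2 * dvec.2 < 0 := by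
    by_contra hge
    exact hk (h1.2 (by linarith))
  fin_cases k <;> rcases hd with rfl | rfl | rfl | rfl <;> simp [dir] at hlt ⊢

/-- **The flat frame.** At a flat point `x` with `x + dir k ∉ V`, within the ball of radius `R`:
`x + j • dir (k+1) + i • dir k ∈ V ↔ i ≤ 0`. [folklore] -/
theorem flat_frame {V : Finset (ℤ × ℤ)} {x dvec : ℤ × ℤ} {R : ℤ}
    (hd : dvec = (1, 0) ∨ dvec = (-1, 0) ∨ dvec = (0, 1) ∨ dvec = (0, -1))
    (hflat : ∀ v : ℤ × ℤ, (v.1 - x.1) ^ 2 + (v.2 - x.2) ^ 2 ≤ R ^ 2 →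
      (v ∈ V ↔ 0 ≤ (v.1 - x.1) * dvec.1 + (v.2 - x.2) * dvec.2))
    (hR : 1 ≤ R) {k : Fin 4} (hk : x + dir k ∉ V) (i j : ℤ) (hij : i ^ 2 + j ^ 2 ≤ R ^ 2) :
    x + j • dir (k + 1) + i • dir k ∈ V ↔ i ≤ 0 := by
  have hdv := flat_dir_eq hd hflat hR hk
  subst hdv
  obtain ⟨a, b⟩ := x
  have key := hflat ((a, b) + j • dir (k + 1) + i • dir k)
  fin_cases k <;> simp [dir] at key ⊢ <;> [exact (key (by nlinarith)).trans (by omega);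
    exact (key (by nlinarith)).trans (by omega); exact (key (by nlinarith)).trans (by omega);
    exact (key (by nlinarith)).trans (by omega)]

/-- **Straight moves.** At a flat point `x` with `x + dir k ∉ V` (radius `R`), for `|j| ≤ R - 2`
the dart `(x + j • dir (k+1), k)` is exterior and its boundary successor is the next dart
`(x + (j+1) • dir (k+1), k)` of the flat stretch. [folklore] -/
theorem dsucc_straight {V : Finset (ℤ × ℤ)} {x dvec : ℤ × ℤ} {R : ℤ}
    (hd : dvec = (1, 0) ∨ dvec = (-1, 0) ∨ dvec = (0, 1) ∨ dvec = (0, -1))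
    (hflat : ∀ v : ℤ × ℤ, (v.1 - x.1) ^ 2 + (v.2 - x.2) ^ 2 ≤ R ^ 2 →
      (v ∈ V ↔ 0 ≤ (v.1 - x.1) * dvec.1 + (v.2 - x.2) * dvec.2))
    (hR : 1 ≤ R) {k : Fin 4} (hk : x + dir k ∉ V) {j : ℤ} (hj : -(R - 2) ≤ j) (hj' : j ≤ R - 2) :
    x + j • dir (k + 1) ∈ V ∧ x + j • dir (k + 1) + dir k ∉ V ∧
      dsucc V (x + j • dir (k + 1), k) = (x + (j + 1) • dir (k + 1), k) := by
  have F := flat_frame hd hflat hR hk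
  have h0 : x + j • dir (k + 1) ∈ V := by
    have := (F 0 j (by nlinarith)).2 le_rfl; simpa using this
  have h1 : x + j • dir (k + 1) + dir k ∉ V := by
    have := (F 1 j (by nlinarith)).1; simp only [one_smul] at this; exact fun hm => absurd (this hm) (by norm_num)
  have hb : (j + 1) ^ 2 ≤ (R - 1) ^ 2 := by
    nlinarith [mul_nonneg (by linarith : (0 : ℤ) ≤ j + 1 + (R - 1)) (by linarith : (0 : ℤ) ≤ (R - 1) - (j + 1))]
  have h0' : x + (j + 1) • dir (k + 1) ∈ V := by
    have := (F 0 (j + 1) (by nlinarith)).2 le_rfl; simpa using this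
  have h1' : x + (j + 1) • dir (k + 1) + dir k ∉ V := by
    have := (F 1 (j + 1) (by nlinarith)).1; simp only [one_smul] at this
    exact fun hm => absurd (this hm) (by norm_num)
  have e1 : x + j • dir (k + 1) + dir (k + 1) = x + (j + 1) • dir (k + 1) := by
    rw [add_zsmul, one_zsmul, add_assoc]
  refine ⟨h0, h1, ?_⟩
  have hA : x + j • dir (k + 1) + dir (k + 1) ∈ V := by rw [e1]; exact h0'
  have hB : x + j • dir (k + 1) + dir (k + 1) + dir k ∉ V := by rw [e1]; exact h1'
  rw [← e1]
  show (if x + j • dir (k + 1) + dir (k + 1) ∉ V then (x + j • dir (k + 1), k + 1)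
    else if x + j • dir (k + 1) + dir (k + 1) + dir k ∉ V then (x + j • dir (k + 1) + dir (k + 1), k)
    else (x + j • dir (k + 1) + dir (k + 1) + dir k, k + 3)) = _
  rw [if_neg (not_not.2 hA), if_pos hB]

/-- Iterating straight moves: `dsucc^[n] (x, k) = (x + n • dir (k+1), k)` for `n ≤ R - 1`.
[folklore] -/
theorem iterate_dsucc_straight {V : Finset (ℤ × ℤ)} {x dvec : ℤ × ℤ} {R : ℤ}
    (hd : dvec = (1, 0) ∨ dvec = (-1, 0) ∨ dvec = (0, 1) ∨ dvec = (0, -1))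
    (hflat : ∀ v : ℤ × ℤ, (v.1 - x.1) ^ 2 + (v.2 - x.2) ^ 2 ≤ R ^ 2 →
      (v ∈ V ↔ 0 ≤ (v.1 - x.1) * dvec.1 + (v.2 - x.2) * dvec.2))
    (hR : 1 ≤ R) {k : Fin 4} (hk : x + dir k ∉ V) :
    ∀ n : ℕ, (n : ℤ) ≤ R - 1 → (dsucc V)^[n] (x, k) = (x + (n : ℤ) • dir (k + 1), k)
  | 0, _ => by simp
  | n + 1, hn => by
    rw [Function.iterate_succ_apply', iterate_dsucc_straight hd hflat hR hk n (by push_cast at hn; omega),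
      (dsucc_straight hd hflat hR hk (j := (n : ℤ)) (by omega) (by push_cast at hn; omega)).2.2]
    push_cast
    rfl

/-! ### Cyclic indexing of the boundary cycle of an admissible datum -/

section Admissible

variable (ι : LegInsertionData) (V : Finset (ℤ × ℤ)) {d₀ : Dart} (hadm : ι.IsAdmissible V)
  (h : outDart V ι.sink = some d₀) {st : ℕ → WalkState}
  (hst : ∀ t, st t = List.foldl (fun s d => s.step (ι.startAt V d)) ι.init ((cycle V d₀).take t))

include hadm h in
/-- `ds[m % P] = dsucc^[m] d₀`. [folklore] -/
theorem getElem_cycle_mod (m : ℕ) :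
    (cycle V d₀)[m % (cycle V d₀).length]'(Nat.mod_lt _ (length_cycle_pos ι V hadm h)) =
      (dsucc V)^[m] d₀ := by
  obtain ⟨hv₀, ht₀⟩ := sinkDart_exterior ι V hadm h
  have hlen : (cycle V d₀).length = period V d₀ := by simp [cycle]
  have hget : ∀ i (hi : i < (cycle V d₀).length), (cycle V d₀)[i] = (dsucc V)^[i] d₀ :=
    fun i hi => by simp [cycle]
  rw [hget, (s3_cycle_orbit V d₀ hv₀ ht₀).2.1 m, hlen]

include hadm h in
/-- The dart after dart `t` (cyclically) is its boundary successor. [folklore] -/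
theorem getElem_succ_mod {t : ℕ} (ht : t < (cycle V d₀).length) :
    (cycle V d₀)[(t + 1) % (cycle V d₀).length]'(Nat.mod_lt _ (length_cycle_pos ι V hadm h)) =
      dsucc V (cycle V d₀)[t] := by
  have hget : (cycle V d₀)[t] = (dsucc V)^[t] d₀ := by simp [cycle]
  rw [getElem_cycle_mod ι V hadm h (t + 1), hget, Function.iterate_succ_apply']

include hadm h in
/-- An exterior `dsucc`-predecessor of dart `t` is dart `(t + P - 1) % P`. [folklore] -/
theorem getElem_pred_mod {t : ℕ} (ht : t < (cycle V d₀).length) {e : Dart} (he : e.1 ∈ V)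
    (het : dartTip e ∉ V) (hs : dsucc V e = (cycle V d₀)[t]) :
    (cycle V d₀)[(t + (cycle V d₀).length - 1) % (cycle V d₀).length]'
        (Nat.mod_lt _ (length_cycle_pos ι V hadm h)) = e := by
  obtain ⟨hv₀, ht₀⟩ := sinkDart_exterior ι V hadm h
  have hP := length_cycle_pos ι V hadm h
  set P := (cycle V d₀).length with hPdef
  have hex := (s3_dsucc_iterate V (t + P - 1)).1 d₀ hv₀ ht₀
  have hmod := getElem_cycle_mod ι V hadm h (t + P - 1)
  apply s3_dsucc_injective V _ _ (by rw [hmod]; exact hex.1) (by rw [hmod]; exact hex.2) he het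
  rw [hs, hmod, ← Function.iterate_succ_apply' (dsucc V)]
  have hget : (cycle V d₀)[t] = (dsucc V)^[t] d₀ := by simp [cycle]
  rw [hget, (s3_cycle_orbit V d₀ hv₀ ht₀).2.1 (t + P - 1).succ, (s3_cycle_orbit V d₀ hv₀ ht₀).2.1 t]
  congr 1
  have hlen : (cycle V d₀).length = period V d₀ := by simp [cycle]
  rw [← hlen, ← hPdef, Nat.succ_eq_add_one, show t + P - 1 + 1 = t + P by omega, Nat.add_mod_right]

include hadm h hst in
/-- **Across the seam.** The state indexed cyclically after dart `t` has the level and the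
wiredness of `st (t + 1)` (for `t + 1 = P`: the walk of an admissible datum closes up). [folklore] -/
theorem st_mod_succ {t : ℕ} (ht : t < (cycle V d₀).length) :
    (st ((t + 1) % (cycle V d₀).length)).level = (st (t + 1)).level ∧
    (st ((t + 1) % (cycle V d₀).length)).wired = (st (t + 1)).wired := by
  by_cases hlt : t + 1 < (cycle V d₀).length
  · rw [Nat.mod_eq_of_lt hlt]; exact ⟨rfl, rfl⟩
  · have hP : t + 1 = (cycle V d₀).length := by omega
    rw [hP, Nat.mod_self]
    obtain ⟨hl, hw, -⟩ := st_final ι V hadm h hst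
    have h0 : st 0 = ι.init := by rw [hst]; rfl
    rw [h0, hl, hw]
    exact ⟨rfl, rfl⟩

/-! ### Footprints -/

include hst in
/-- **Legs are pending only inside a footprint.** If legs are pending after `s` darts, an insertion
of `L₀` legs started at a dart `s₀ < s` with `pending + (s - s₀) ≤ L₀`. [folklore] -/
theorem exists_start_of_pending {s : ℕ} (hs : s ≤ (cycle V d₀).length) (hp : (st s).pending ≠ 0) :
    ∃ (s₀ : ℕ) (hs₀ : s₀ < s) (L₀ : ℕ) (σ : ℤ),
      ι.startAt V ((cycle V d₀)[s₀]'(lt_of_lt_of_le hs₀ hs)) = some (L₀, σ) ∧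
      (st s).pending + (s - s₀) ≤ L₀ := by
  induction s with
  | zero => exact absurd (by rw [hst]; rfl) hp
  | succ s ih =>
    have hs' : s < (cycle V d₀).length := by omega
    have hstep := st_succ ι V hst hs'
    rcases hsa : ι.startAt V (cycle V d₀)[s] with _ | ⟨L₀, σ⟩
    · rw [hsa] at hstep
      have hle := pending_step_none_le (st s)
      rw [← hstep] at hle
      have hp' : (st s).pending ≠ 0 := by omega
      obtain ⟨s₀, hs₀, L₁, σ₁, hst₀, hb⟩ := ih (by omega) hp'
      exact ⟨s₀, by omega, L₁, σ₁, hst₀, by omega⟩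
    · rw [hsa] at hstep
      have hle := pending_step_some_le (st s) L₀ σ
      rw [← hstep] at hle
      exact ⟨s, by omega, L₀, σ, hsa, by omega⟩

/-- An insertion of `0` legs is silent. [folklore] -/
theorem step_some_zero (s : WalkState) (σ : ℤ) :
    (s.step (some (0, σ))).level = s.level ∧ (s.step (some (0, σ))).wired = s.wired := by
  simp [WalkState.step]

include hst in
/-- **An active dart lies in a footprint.** If dart `s` changes the level or the wiredness, then
an insertion of `L₀` legs started at a dart `s₀ ≤ s` with `s - s₀ + 1 ≤ L₀`. [folklore] -/
theorem exists_start_of_active {s : ℕ} (hs : s < (cycle V d₀).length)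
    (hact : ¬ ((st (s + 1)).level = (st s).level ∧ (st (s + 1)).wired = (st s).wired)) :
    ∃ (s₀ : ℕ) (hs₀ : s₀ ≤ s) (L₀ : ℕ) (σ : ℤ),
      ι.startAt V ((cycle V d₀)[s₀]'(lt_of_le_of_lt hs₀ hs)) = some (L₀, σ) ∧ s - s₀ + 1 ≤ L₀ := by
  have hstep := st_succ ι V hst hs
  rcases hsa : ι.startAt V (cycle V d₀)[s] with _ | ⟨L₀, σ⟩
  · rw [hsa] at hstep
    by_cases hp : (st s).pending = 0
    · rw [step_none_of_pending _ hp] at hstep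
      exact absurd ⟨by rw [hstep], by rw [hstep]⟩ hact
    · obtain ⟨s₀, hs₀, L₁, σ₁, hst₀, hb⟩ := exists_start_of_pending ι V hst hs.le hp
      exact ⟨s₀, hs₀.le, L₁, σ₁, hst₀, by omega⟩
  · rw [hsa] at hstep
    refine ⟨s, le_rfl, L₀, σ, hsa, ?_⟩
    rcases Nat.eq_zero_or_pos L₀ with rfl | hL
    · obtain ⟨hl, hw⟩ := step_some_zero (st s) σ
      rw [← hstep] at hl hw
      exact absurd ⟨hl, hw⟩ hact
    · omega

/-- **Where insertions start.** `startAt d = some (L₀, σ)` means: `d` is the exterior dart of an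
insertion point (the sink, `L₀ = L`, or a source `x`, `L₀ = legs x ≤ L`). [folklore] -/
theorem startAt_eq_some {d : Dart} {L₀ : ℕ} {σ : ℤ} (hsa : ι.startAt V d = some (L₀, σ)) :
    d.1 ∈ insert ι.sink ι.source ∧ outDart V d.1 = some d ∧ L₀ ≤ ι.sinkLegs := by
  unfold LegInsertionData.startAt at hsa
  split_ifs at hsa with h1 h2
  · obtain ⟨hd1, -⟩ := s3_outDart_some V _ _ h1
    simp only [Option.some.injEq, Prod.mk.injEq] at hsa
    refine ⟨by rw [hd1]; exact Finset.mem_insert_self _ _, by rw [hd1]; exact h1, by rw [hsa.1]⟩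
  · simp only [Option.some.injEq, Prod.mk.injEq] at hsa
    refine ⟨Finset.mem_insert_of_mem h2.1, h2.2, ?_⟩
    rw [← hsa.1]
    exact Finset.single_le_sum (fun _ _ => Nat.zero_le _) h2.1

include hadm h hst in
/-- **The neighbours of an active dart are its straight translates.** If every insertion point is
flat at radius `L + 3` and dart `s = (y, k)` is active, then, cyclically, the next two darts are
`(y + dir (k+1), k)`, `(y + 2 • dir (k+1), k)` and the previous two `(y - dir (k+1), k)`,
`(y - 2 • dir (k+1), k)`; all five are exterior darts of the flat stretch of an insertion point.
[folklore] -/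
theorem straight_of_active
    (hflat : ∀ x ∈ insert ι.sink ι.source, ∃ dvec : ℤ × ℤ,
      (dvec = (1, 0) ∨ dvec = (-1, 0) ∨ dvec = (0, 1) ∨ dvec = (0, -1)) ∧
      ∀ v : ℤ × ℤ, (v.1 - x.1) ^ 2 + (v.2 - x.2) ^ 2 ≤ ((ι.sinkLegs : ℤ) + 3) ^ 2 →
        (v ∈ V ↔ 0 ≤ (v.1 - x.1) * dvec.1 + (v.2 - x.2) * dvec.2))
    {s : ℕ} (hs : s < (cycle V d₀).length)
    (hact : ¬ ((st (s + 1)).level = (st s).level ∧ (st (s + 1)).wired = (st s).wired)) :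
    ∃ (y : ℤ × ℤ) (k : Fin 4), (cycle V d₀)[s] = (y, k) ∧
      (cycle V d₀)[(s + 1) % (cycle V d₀).length]'(Nat.mod_lt _ (length_cycle_pos ι V hadm h)) =
        (y + dir (k + 1), k) ∧
      (cycle V d₀)[((s + 1) % (cycle V d₀).length + 1) % (cycle V d₀).length]'
          (Nat.mod_lt _ (length_cycle_pos ι V hadm h)) = (y + (2 : ℤ) • dir (k + 1), k) ∧
      (cycle V d₀)[(s + (cycle V d₀).length - 1) % (cycle V d₀).length]'
          (Nat.mod_lt _ (length_cycle_pos ι V hadm h)) = (y - dir (k + 1), k) ∧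
      (cycle V d₀)[((s + (cycle V d₀).length - 1) % (cycle V d₀).length + (cycle V d₀).length - 1) %
          (cycle V d₀).length]'(Nat.mod_lt _ (length_cycle_pos ι V hadm h)) =
        (y - (2 : ℤ) • dir (k + 1), k) := by
  have hP := length_cycle_pos ι V hadm h
  obtain ⟨s₀, hs₀, L₀, σ, hsa, hj₀⟩ := exists_start_of_active ι V hst hs hact
  obtain ⟨hx, hout, hL₀⟩ := startAt_eq_some ι V hsa
  rcases hdk : (cycle V d₀)[s₀] with ⟨x, k⟩
  rw [hdk] at hx hout
  simp only at hx hout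
  obtain ⟨-, hk⟩ := s3_outDart_some V x _ hout
  simp only at hk
  obtain ⟨dvec, hd, hfl⟩ := hflat x hx
  have hR : (1 : ℤ) ≤ (ι.sinkLegs : ℤ) + 3 := by omega
  -- the active dart is dart `j₀ = s - s₀` of the footprint
  set j₀ : ℕ := s - s₀ with hj₀def
  have hsj : s = j₀ + s₀ := by omega
  have hys : (cycle V d₀)[s] = (x + (j₀ : ℤ) • dir (k + 1), k) := by
    have h1 : (cycle V d₀)[s] = (dsucc V)^[s] d₀ := by simp [cycle]
    have h2 : (cycle V d₀)[s₀] = (dsucc V)^[s₀] d₀ := by simp [cycle]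
    rw [h1, hsj, Function.iterate_add_apply, ← h2, hdk]
    exact iterate_dsucc_straight hd hfl hR hk j₀ (by omega)
  refine ⟨x + (j₀ : ℤ) • dir (k + 1), k, hys, ?_, ?_, ?_, ?_⟩
  · rw [getElem_succ_mod ι V hadm h hs, hys,
      (dsucc_straight hd hfl hR hk (j := (j₀ : ℤ)) (by omega) (by omega)).2.2, add_zsmul, one_zsmul,
      add_assoc]
  · rw [getElem_succ_mod ι V hadm h (Nat.mod_lt _ hP), getElem_succ_mod ι V hadm h hs, hys,
      (dsucc_straight hd hfl hR hk (j := (j₀ : ℤ)) (by omega) (by omega)).2.2,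
      (dsucc_straight hd hfl hR hk (j := (j₀ : ℤ) + 1) (by omega) (by omega)).2.2]
    refine Prod.ext ?_ rfl
    simp only [add_smul, one_smul, two_smul]
    abel
  · have hpr := dsucc_straight hd hfl hR hk (j := (j₀ : ℤ) - 1) (by omega) (by omega)
    rw [sub_add_cancel] at hpr
    have := getElem_pred_mod ι V hadm h hs (e := (x + ((j₀ : ℤ) - 1) • dir (k + 1), k)) hpr.1
      (by simpa [dartTip] using hpr.2.1) (by rw [hpr.2.2, hys])
    rw [this]
    refine Prod.ext ?_ rfl
    simp only [sub_smul, one_smul]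
    abel
  · have hpr := dsucc_straight hd hfl hR hk (j := (j₀ : ℤ) - 1) (by omega) (by omega)
    rw [sub_add_cancel] at hpr
    have h1 := getElem_pred_mod ι V hadm h hs (e := (x + ((j₀ : ℤ) - 1) • dir (k + 1), k)) hpr.1
      (by simpa [dartTip] using hpr.2.1) (by rw [hpr.2.2, hys])
    have hpr2 := dsucc_straight hd hfl hR hk (j := (j₀ : ℤ) - 2) (by omega) (by omega)
    rw [show (j₀ : ℤ) - 2 + 1 = (j₀ : ℤ) - 1 by ring] at hpr2
    have h2 := getElem_pred_mod ι V hadm h (Nat.mod_lt _ hP)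
      (e := (x + ((j₀ : ℤ) - 2) • dir (k + 1), k)) hpr2.1 (by simpa [dartTip] using hpr2.2.1)
      (by rw [hpr2.2.2, h1])
    rw [h2]
    refine Prod.ext ?_ rfl
    simp only [sub_smul, two_smul]
    abel

end Admissible

/-! ### Registered one-line form -/

/-- **Sub-goal `s13_flatStraight`** (registered on stmt-CriticalPhenomena-14132): at a flat
insertion point `x` (half-plane chart of radius `R` with inward normal `dvec`) with exterior
direction `k`, the darts `(x + j • dir (k+1), k)`, `|j| ≤ R - 2`, of the flat stretch are exterior
and the boundary walk moves them STRAIGHT — the geometric input of the footprint analysis.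
[folklore] -/
theorem s13_flatStraight : ∀ (V : Finset (ℤ × ℤ)) (x dvec : ℤ × ℤ) (R : ℤ) (k : Fin 4) (j : ℤ), (dvec = (1, 0) ∨ dvec = (-1, 0) ∨ dvec = (0, 1) ∨ dvec = (0, -1)) → (∀ v : ℤ × ℤ, (v.1 - x.1) ^ 2 + (v.2 - x.2) ^ 2 ≤ R ^ 2 → (v ∈ V ↔ 0 ≤ (v.1 - x.1) * dvec.1 + (v.2 - x.2) * dvec.2)) → 1 ≤ R → x + Literature.Probability.LatticeModels.CollarLegModel.dir k ∉ V → -(R - 2) ≤ j → j ≤ R - 2 → x + j • Literature.Probability.LatticeModels.CollarLegModel.dir (k + 1) ∈ V ∧ x + j • Literature.Probability.LatticeModels.CollarLegModel.dir (k + 1) + Literature.Probability.LatticeModels.CollarLegModel.dir k ∉ V ∧ Literature.Probability.LatticeModels.CollarLegModel.dsucc V (x + j • Literature.Probability.LatticeModels.CollarLegModel.dir (k + 1), k) = (x + (j + 1) • Literature.Probability.LatticeModels.CollarLegModel.dir (k + 1), k) :=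
  fun _ _ _ _ _ _ hd hflat hR hk hj hj' => dsucc_straight hd hflat hR hk hj hj'

end Summit.CriticalPhenomena.CardyFormulaZ2.Cruxes.BoundaryDefectGaussianR.RainbowMonomialsInExcursionKernels
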